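import Summits.QuantumFields.YangMills.Theorems.BalabanUVNodesN15CovariantLandauTwoGridMinimizers
import Summits.QuantumFields.YangMills.Theorems.BalabanUVNodesN15CovariantLandauProjection
import HarnessLib

/-!
# Route «BalabanUVNodes», node N15 = NE2, road (c) — PROGRAMME (P-S), XXXII: THE TWO-GRID η-DEFECT OF THE COVARIANT LANDAU TERM `D_T(I − R(T))D_Tᵀ = E·S⁻¹·Eᵀ`
# FROM THE DEFECTS OF `M`, `E` AND THEIR TRANSPOSES (three-defect split; `νS′ − S = M′ᵀ𝔇(M) + 𝔇(Mᵀ)M`, `𝔇(S⁻¹) = −S′⁻¹(νS′ − S)S⁻¹` exactly) (dag-n15-c g24, n15-c∕239; HOME «(G3)»)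

Cell `pub-ymgap`, seat `pub-ymgap-dag-n15-c` (generation g24; R134 (a), s1; HUMAN RULING D-0062; chair R424 venue).  `bears_on: R4∕N15 · K3⁸ SpineGivenEndpointR13SepCoPHV
(stmt-QuantumFields-27366)`; filed `--supports stmt-QuantumFields-27366 --as helper` — COUNT-NEUTRAL.  Theorems only; 0 `sorry`.  Imports BY NAME n15-c∕212 (`landauCov_eq`, `cSop_eq_transpose_mul`),
199 (`isUnit_cSop`), 238 (`hasMaj_mulVecLin_transpose`), 214 (`card_fibre_blkS∕blkV`), lit-balaban∕b11 (`hasMaj_comp_exp`), the T⁴ cell (`idef`, `idef_comp`).  Nothing in the tree is modified.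

THE MECHANISM.  With the scaled unit transport `ν·id` (n15-c∕238): `L′P̂_V − P̂_VL = E′·[S′⁻¹·𝔇(Eᵀ) + 𝔇(S⁻¹)·Eᵀ] + 𝔇(E)·S⁻¹Eᵀ` (`idef_comp` twice), `𝔇(Eᵀ) = E′ᵀP̂_V − Eᵀ`, `𝔇(S⁻¹) = S′⁻¹ − νS⁻¹ =
−S′⁻¹(νS′ − S)S⁻¹` (two-sided inverses, n15-c∕199), `νS′ − S = M′ᵀ·𝔇(M) + 𝔇(Mᵀ)·M`.  Every product of grid powers cancels (`E ~ n^{−(d+1)}`, `S⁻¹ ~ n^{d+1}`, `ν = (n′∕n)^{d+1}`): the constant is n-free.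
* `mulVecLin_nu_cSop_sub` (the identity for `νS′ − S`), `hasMaj_nu_cSop_sub`; `cSop_inv_sub_nu` (the resolvent identity), `hasMaj_idef_cSop_inv`; ★★★ **`hasMaj_idef_landauCov`**:
  `𝔇(E′S′⁻¹E′ᵀ, ES⁻¹Eᵀ) ≤ E_L·e^{−(δ−5s)d}`, `E_L = c_E′c_S′ε_Eᵀc² + c_E′c_S′c_S(|ι|c_M′ε_M + ε_Mᵀc_M)c⁵(d+1)|ι|c_E + ε_Ec_S(d+1)|ι|c_Ec²` — inputs: one-grid rows of `M, E, S⁻¹` (both grids) and the four defects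
  `ε_M, ε_E` (238 `hasMaj_idef_cM∕cE`), `ε_Mᵀ, ε_Eᵀ` (238 `…_transpose`).

HONEST FRAMING ∕ LIMITS.  Bookkeeping over displayed rows; MODEL carriers; NOT [Balaban1985BackgroundPropagators] (3.49) ∕ Thm 3.4 as printed; NE2⁺ NOT PRINTED; N15 of record untouched (DISCHARGED AS
CONSUMED, p687738); counts UNMOVED (typed 28∕28 · discharged 8∕27); one finite 𝕋⁴ at fixed ε per index — NOT infinite volume ∕ OS ∕ mass gap ∕ Clay.  Restate-immune.
-/

noncomputable section

open scoped BigOperators Matrix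
open Finset

namespace Summit.QuantumFields.YangMills.BalabanUVNodes.N15.CovLandau

open Literature.MathematicalPhysics.QuantumFieldTheory.Balaban1983to89
open Literature.MathematicalPhysics.QuantumFieldTheory.Balaban1983to89.B5Prop11Plancherel (Tor fine unitVec)
open Literature.MathematicalPhysics.QuantumFieldTheory.Balaban1983to89.B11SectG (BlockNorm HasMaj RowSum hasMaj_comp_exp)
open Literature.MathematicalPhysics.QuantumFieldTheory.Balaban1983to89.B6UnitTorusCarrier (unitTorusGeo rowSum_unitTorusGeo triangle254_unitTorusGeo unitTorusGeo_dist_nonneg)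
open Literature.MathematicalPhysics.QuantumFieldTheory.Balaban1983to89.T4EtaRateDefect (idef idef_apply idef_comp idef_add idef_sub)
open Literature.MathematicalPhysics.QuantumFieldTheory.Balaban1983to89.T4EtaRateCoeffDefect (pull pull_apply fibre mem_fibre)
open Literature.MathematicalPhysics.QuantumFieldTheory.King1986.Torus (blockOf tdistT tdistT_nonneg tdistT_symm tdistT_self)
open Summit.QuantumFields.YangMills.BalabanUVNodes.N15.MatrixSpecies (liftBlk liftMap)
open Summit.QuantumFields.YangMills.BalabanUVNodes.N15.VectorPiece (kingPr kingPrV)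
open Summit.QuantumFields.YangMills.BalabanUVNodes.N15.BackgroundModel (kappa_ofBlocks)
open Summit.QuantumFields.YangMills.BalabanUVNodes.N15.BlockRows (hasMaj_comp_localRight hasMaj_comp_localLeft)

variable {d : ℕ}

section Landau

variable (M : Fin (d + 1) → ℕ) [∀ μ, NeZero (M μ)] {ι : Type} [Fintype ι] [DecidableEq ι] (L k m : ℕ) [NeZero L]

/-- `νS′ − S = M′ᵀ·𝔇(M) + 𝔇(Mᵀ)·M` (`S = MᵀM`, `𝔇(M) = νM′ − P̂_SM`, `𝔇(Mᵀ) = M′ᵀP̂_S − Mᵀ`) as linear maps. [cite: Balaban1985BackgroundPropagators, Thm 3.2 (3.48) p.398 (the object), Thm 3.4 p.400 (perturbation mechanism)] -/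
theorem mulVecLin_nu_cSop_sub (T : Fin (d + 1) → Tor (fine (L ^ k) M) → Matrix ι ι ℝ) (a : ℝ) (T' : Fin (d + 1) → Tor (fine (L ^ m * L ^ k) M) → Matrix ι ι ℝ) (a' : ℝ) :
    Matrix.mulVecLin (((((L ^ m) ^ (d + 1) : ℕ) : ℝ)) • (cSop M (L ^ m * L ^ k) T' a') - (cSop M (L ^ k) T a)) =
      Matrix.mulVecLin ((cM M (L ^ m * L ^ k) T' a'))ᵀ ∘ₗ idef (((((L ^ m) ^ (d + 1) : ℕ) : ℝ)) • (LinearMap.id : (Tor M × ι → ℝ) →ₗ[ℝ] (Tor M × ι → ℝ))) (pull (liftMap (kingPr L k m M) ι)) (Matrix.mulVecLin (cM M (L ^ m * L ^ k) T' a')) (Matrix.mulVecLin (cM M (L ^ k) T a)) + idef (pull (liftMap (kingPr L k m M) ι)) (LinearMap.id : (Tor M × ι → ℝ) →ₗ[ℝ] (Tor M × ι → ℝ)) (Matrix.mulVecLin ((cM M (L ^ m * L ^ k) T' a'))ᵀ) (Matrix.mulVecLin ((cM M (L ^ k) T a))ᵀ) ∘ₗ Matrix.mulVecLin (cM M (L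 ^ k) T a) := by
  rw [cSop_eq_transpose_mul, cSop_eq_transpose_mul, idef, idef, mulVecLin_sub', mulVecLin_smul', Matrix.mulVecLin_mul ((cM M (L ^ m * L ^ k) T' a'))ᵀ (cM M (L ^ m * L ^ k) T' a'), Matrix.mulVecLin_mul ((cM M (L ^ k) T a))ᵀ (cM M (L ^ k) T a)]
  simp only [LinearMap.comp_sub, LinearMap.sub_comp, LinearMap.comp_smul, LinearMap.comp_id, LinearMap.id_comp, LinearMap.comp_assoc]
  abel

/-- `S′⁻¹ − νS⁻¹ = −S′⁻¹(νS′ − S)S⁻¹` (two-sided inverses by n15-c∕199 `isUnit_cSop`). [cite: Balaban1985BackgroundPropagators, Thm 3.4 p.400 (the operator `(Q′G′²Q′*)⁻¹` among the perturbed ones)] -/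
theorem cSop_inv_sub_nu {T : Fin (d + 1) → Tor (fine (L ^ k) M) → Matrix ι ι ℝ} (hT : ∀ ν x, IsUnit (T ν x)) {a : ℝ} (ha : 0 < a)
    {T' : Fin (d + 1) → Tor (fine (L ^ m * L ^ k) M) → Matrix ι ι ℝ} (hT' : ∀ ν x, IsUnit (T' ν x)) {a' : ℝ} (ha' : 0 < a') :
    ((cSop M (L ^ m * L ^ k) T' a'))⁻¹ - ((((L ^ m) ^ (d + 1) : ℕ) : ℝ)) • ((cSop M (L ^ k) T a))⁻¹ = -(((cSop M (L ^ m * L ^ k) T' a'))⁻¹ * (((((L ^ m) ^ (d + 1) : ℕ) : ℝ)) • (cSop M (L ^ m * L ^ k) T' a') - (cSop M (L ^ k) T a)) * ((cSop M (L ^ k) T a))⁻¹) := by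
  have hU : IsUnit ((cSop M (L ^ k) T a)).det := (Matrix.isUnit_iff_isUnit_det _).mp (isUnit_cSop M (L ^ k) hT ha)
  have hU' : IsUnit ((cSop M (L ^ m * L ^ k) T' a')).det := (Matrix.isUnit_iff_isUnit_det _).mp (isUnit_cSop M (L ^ m * L ^ k) hT' ha')
  rw [Matrix.mul_sub, Matrix.sub_mul, Matrix.mul_smul, Matrix.smul_mul, Matrix.nonsing_inv_mul _ hU', Matrix.mul_assoc, Matrix.mul_nonsing_inv _ hU, Matrix.one_mul, Matrix.mul_one,
    neg_sub]

set_option maxHeartbeats 1600000 in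
/-- ★★★ **THE TWO-GRID η-DEFECT OF THE COVARIANT LANDAU TERM `E·S⁻¹·Eᵀ = D_T(I − R(T))D_Tᵀ`** between the grids `n = L^k` and `n′ = L^mL^k` from the one-grid rows of `M, E, S⁻¹` (both grids; the
grid powers `n^{∓(d+1)}` displayed) and the four two-grid defects `ε_M, ε_E` (scaled transport), `ε_Mᵀ, ε_Eᵀ` (n15-c∕238) — the constant `E_L` (docstring of the file) is free of `n, n′`.
[cite: Balaban1985BackgroundPropagators, (3.49) p.399 («using again Lemma 2.1»), Thm 3.4 p.400, Thm 3.14 pp.426–427 (two spacings: mechanism); King1986, p.664, Prop. 3.9 (3.73) p.665 (shape)] -/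
theorem hasMaj_idef_landauCov
    {T : Fin (d + 1) → Tor (fine (L ^ k) M) → Matrix ι ι ℝ} (hT : ∀ ν x, IsUnit (T ν x)) {a : ℝ} (ha : 0 < a)
    {T' : Fin (d + 1) → Tor (fine (L ^ m * L ^ k) M) → Matrix ι ι ℝ} (hT' : ∀ ν x, IsUnit (T' ν x)) {a' : ℝ} (ha' : 0 < a')
    {δ s c cM₀ cM₁ cE₀ cE₁ cS₀ cS₁ εM εE εMt εEt : ℝ} (hs : 0 < s) (hsδ : 5 * s ≤ δ) (hrow : RowSum (unitTorusGeo L k M) s c) (hc : 0 ≤ c)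
    (hcM₀ : 0 ≤ cM₀) (hcM₁ : 0 ≤ cM₁) (hcE₀ : 0 ≤ cE₀) (hcE₁ : 0 ≤ cE₁) (hcS₀ : 0 ≤ cS₀) (hcS₁ : 0 ≤ cS₁) (hεM : 0 ≤ εM) (hεE : 0 ≤ εE) (hεMt : 0 ≤ εMt) (hεEt : 0 ≤ εEt)
    (hM : HasMaj (BlockNorm.ofBlocks (unitTorusGeo L k M) (liftBlk (fun y : Tor M => y) ι)) (BlockNorm.ofBlocks (unitTorusGeo L k M) (liftBlk (blockOf (L ^ k) M) ι)) (Matrix.mulVecLin (cM M (L ^ k) T a)) (fun y y' => (((((L ^ k : ℕ) : ℝ)) ^ (d + 1)))⁻¹ * cM₀ * Real.exp (-(δ * tdistT M y y'))))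
    (hM' : HasMaj (BlockNorm.ofBlocks (unitTorusGeo L k M) (liftBlk (fun y : Tor M => y) ι)) (BlockNorm.ofBlocks (unitTorusGeo L k M) (liftBlk (blockOf (L ^ m * L ^ k) M) ι)) (Matrix.mulVecLin (cM M (L ^ m * L ^ k) T' a')) (fun y y' => (((((L ^ m * L ^ k : ℕ) : ℝ)) ^ (d + 1)))⁻¹ * cM₁ * Real.exp (-(δ * tdistT M y y'))))
    (hE : HasMaj (BlockNorm.ofBlocks (unitTorusGeo L k M) (liftBlk (fun y : Tor M => y) ι)) (BlockNorm.ofBlocks (unitTorusGeo L k M) (liftBlk (fun b : Tor (fine (L ^ k) M) × Fin (d + 1) => blockOf (L ^ k) M b.1) ι)) (Matrix.mulVecLin (cE M (L ^ k) T a)) (fun y y' => (((((L ^ k : ℕ) : ℝ)) ^ (d + 1)))⁻¹ * cE₀ * Real.exp (-(δ * tdistT M y y'))))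
    (hE' : HasMaj (BlockNorm.ofBlocks (unitTorusGeo L k M) (liftBlk (fun y : Tor M => y) ι)) (BlockNorm.ofBlocks (unitTorusGeo L k M) (liftBlk (fun b : Tor (fine (L ^ m * L ^ k) M) × Fin (d + 1) => blockOf (L ^ m * L ^ k) M b.1) ι)) (Matrix.mulVecLin (cE M (L ^ m * L ^ k) T' a')) (fun y y' => (((((L ^ m * L ^ k : ℕ) : ℝ)) ^ (d + 1)))⁻¹ * cE₁ * Real.exp (-(δ * tdistT M y y'))))
    (hSi : HasMaj (BlockNorm.ofBlocks (unitTorusGeo L k M) (liftBlk (fun y : Tor M => y) ι)) (BlockNorm.ofBlocks (unitTorusGeo L k M) (liftBlk (fun y : Tor M => y) ι)) (Matrix.mulVecLin ((cSop M (L ^ k) T a))⁻¹) (fun y y' => ((((L ^ k : ℕ) : ℝ)) ^ (d + 1)) * cS₀ * Real.exp (-(δ * tdistT M y y'))))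
    (hSi' : HasMaj (BlockNorm.ofBlocks (unitTorusGeo L k M) (liftBlk (fun y : Tor M => y) ι)) (BlockNorm.ofBlocks (unitTorusGeo L k M) (liftBlk (fun y : Tor M => y) ι)) (Matrix.mulVecLin ((cSop M (L ^ m * L ^ k) T' a'))⁻¹) (fun y y' => ((((L ^ m * L ^ k : ℕ) : ℝ)) ^ (d + 1)) * cS₁ * Real.exp (-(δ * tdistT M y y'))))
    (hDM : HasMaj (BlockNorm.ofBlocks (unitTorusGeo L k M) (liftBlk (fun y : Tor M => y) ι)) (BlockNorm.ofBlocks (unitTorusGeo L k M) (liftBlk (blockOf (L ^ m * L ^ k) M) ι)) (idef (((((L ^ m) ^ (d + 1) : ℕ) : ℝ)) • (LinearMap.id : (Tor M × ι → ℝ) →ₗ[ℝ] (Tor M × ι → ℝ))) (pull (liftMap (kingPr L k m M) ι)) (Matrix.mulVecLin (cM M (L ^ m * L ^ k) T' a')) (Matrix.mulVecLin (cM M (L ^ k) T a))) (fun y y' => (((((L ^ k : ℕ) : ℝ)) ^ (d + 1)))⁻¹ * εM * Real.exp (-(δ * tdistT M y y'))))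
    (hDE : HasMaj (BlockNorm.ofBlocks (unitTorusGeo L k M) (liftBlk (fun y : Tor M => y) ι)) (BlockNorm.ofBlocks (unitTorusGeo L k M) (liftBlk (fun b : Tor (fine (L ^ m * L ^ k) M) × Fin (d + 1) => blockOf (L ^ m * L ^ k) M b.1) ι)) (idef (((((L ^ m) ^ (d + 1) : ℕ) : ℝ)) • (LinearMap.id : (Tor M × ι → ℝ) →ₗ[ℝ] (Tor M × ι → ℝ))) (pull (liftMap (kingPrV L k m M) ι)) (Matrix.mulVecLin (cE M (L ^ m * L ^ k) T' a')) (Matrix.mulVecLin (cE M (L ^ k) T a))) (fun y y' => (((((L ^ k : ℕ) : ℝ)) ^ (d + 1)))⁻¹ * εE * Real.exp (-(δ * tdistT M y y'))))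
    (hDMt : HasMaj (BlockNorm.ofBlocks (unitTorusGeo L k M) (liftBlk (blockOf (L ^ k) M) ι)) (BlockNorm.ofBlocks (unitTorusGeo L k M) (liftBlk (fun y : Tor M => y) ι)) (idef (pull (liftMap (kingPr L k m M) ι)) (LinearMap.id : (Tor M × ι → ℝ) →ₗ[ℝ] (Tor M × ι → ℝ)) (Matrix.mulVecLin ((cM M (L ^ m * L ^ k) T' a'))ᵀ) (Matrix.mulVecLin ((cM M (L ^ k) T a))ᵀ)) (fun y y' => εMt * Real.exp (-(δ * tdistT M y y'))))
    (hDEt : HasMaj (BlockNorm.ofBlocks (unitTorusGeo L k M) (liftBlk (fun b : Tor (fine (L ^ k) M) × Fin (d + 1) => blockOf (L ^ k) M b.1) ι)) (BlockNorm.ofBlocks (unitTorusGeo L k M) (liftBlk (fun y : Tor M => y) ι)) (idef (pull (liftMap (kingPrV L k m M) ι)) (LinearMap.id : (Tor M × ι → ℝ) →ₗ[ℝ] (Tor M × ι → ℝ)) (Matrix.mulVecLin ((cE M (L ^ m * L ^ k) T' a'))ᵀ) (Matrix.mulVecLin ((cE M (L ^ k) T a))ᵀ)) (fun y y' => εEt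 * Real.exp (-(δ * tdistT M y y')))) :
    HasMaj (BlockNorm.ofBlocks (unitTorusGeo L k M) (liftBlk (fun b : Tor (fine (L ^ k) M) × Fin (d + 1) => blockOf (L ^ k) M b.1) ι)) (BlockNorm.ofBlocks (unitTorusGeo L k M) (liftBlk (fun b : Tor (fine (L ^ m * L ^ k) M) × Fin (d + 1) => blockOf (L ^ m * L ^ k) M b.1) ι)) (idef (pull (liftMap (kingPrV L k m M) ι)) (pull (liftMap (kingPrV L k m M) ι)) (Matrix.mulVecLin (landauCov M (L ^ m * L ^ k) T' a')) (Matrix.mulVecLin (landauCov M (L ^ k) T a))) (fun y y' => (cE₁ * (cS₁ * εEt * c) * c + cE₁ * ((cS₁ * cS₀ * ((Fintype.card ι * cM₁ * εM + εMt * cM₀) * c) * c * c) * (((d : ℝ) + 1) * Fintype.card ι * cE₀) * c) * c + εE * (cS₀ * (((d : ℝ) + 1) * Fintype.card ι * cE₀) * c) * c) * Real.exp (-((δ - 5 * s) * tdistT M y y'))) := by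
  have hκS : (BlockNorm.ofBlocks (unitTorusGeo L k M) (liftBlk (blockOf (L ^ k) M) ι)).κ = 1 := kappa_ofBlocks _
  have hκV : (BlockNorm.ofBlocks (unitTorusGeo L k M) (liftBlk (fun b : Tor (fine (L ^ k) M) × Fin (d + 1) => blockOf (L ^ k) M b.1) ι)).κ = 1 := kappa_ofBlocks _
  have hκS1 : (BlockNorm.ofBlocks (unitTorusGeo L k M) (liftBlk (blockOf (L ^ m * L ^ k) M) ι)).κ = 1 := kappa_ofBlocks _
  have hκV1 : (BlockNorm.ofBlocks (unitTorusGeo L k M) (liftBlk (fun b : Tor (fine (L ^ m * L ^ k) M) × Fin (d + 1) => blockOf (L ^ m * L ^ k) M b.1) ι)).κ = 1 := kappa_ofBlocks _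
  have hκU : (BlockNorm.ofBlocks (unitTorusGeo L k M) (liftBlk (fun y : Tor M => y) ι)).κ = 1 := kappa_ofBlocks _
  have hn : (0 : ℝ) < ((((L ^ k : ℕ) : ℝ)) ^ (d + 1)) := pow_pos (Nat.cast_pos.mpr (Nat.pos_of_ne_zero (NeZero.ne _))) _
  have hn' : (0 : ℝ) < ((((L ^ m * L ^ k : ℕ) : ℝ)) ^ (d + 1)) := pow_pos (Nat.cast_pos.mpr (Nat.pos_of_ne_zero (NeZero.ne _))) _
  have hNU : (0 : ℝ) < ((((L ^ m) ^ (d + 1) : ℕ) : ℝ)) := Nat.cast_pos.mpr (pow_pos (pow_pos (Nat.pos_of_ne_zero (NeZero.ne L)) _) _)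
  have hδ : 0 ≤ δ := by linarith
  have htri := triangle254_unitTorusGeo L k M
  have hd := unitTorusGeo_dist_nonneg L k M
  -- transposed one-grid rows (block cardinalities n′^{d+1}|ι| and (d+1)n^{d+1}|ι|)
  have hMt' : HasMaj (BlockNorm.ofBlocks (unitTorusGeo L k M) (liftBlk (blockOf (L ^ m * L ^ k) M) ι)) (BlockNorm.ofBlocks (unitTorusGeo L k M) (liftBlk (fun y : Tor M => y) ι)) (Matrix.mulVecLin ((cM M (L ^ m * L ^ k) T' a'))ᵀ) (fun y y' => ((((L ^ m * L ^ k) ^ (d + 1) * Fintype.card ι : ℕ) : ℝ) * ((((((L ^ m * L ^ k : ℕ) : ℝ)) ^ (d + 1)))⁻¹ * cM₁)) * Real.exp (-(δ * tdistT M y y'))) :=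
    (hasMaj_mulVecLin_transpose (g := unitTorusGeo L k M) (liftBlk (fun y : Tor M => y) ι) (liftBlk (blockOf (L ^ m * L ^ k) M) ι) (K := fun y y' => (((((L ^ m * L ^ k : ℕ) : ℝ)) ^ (d + 1)))⁻¹ * cM₁ * Real.exp (-(δ * tdistT M y y'))) (N := (L ^ m * L ^ k) ^ (d + 1) * Fintype.card ι)
      (fun y y' => by positivity) (fun z => (card_fibre_blkS M (L ^ m * L ^ k) ι z).le) hM').mono fun y y' => le_of_eq (by rw [tdistT_symm M y' y]; ring)
  have hEt : HasMaj (BlockNorm.ofBlocks (unitTorusGeo L k M) (liftBlk (fun b : Tor (fine (L ^ k) M) × Fin (d + 1) => blockOf (L ^ k) M b.1) ι)) (BlockNorm.ofBlocks (unitTorusGeo L k M) (liftBlk (fun y : Tor M => y) ι)) (Matrix.mulVecLin ((cE M (L ^ k) T a))ᵀ) (fun y y' => (((((d + 1) * (L ^ k) ^ (d + 1) * Fintype.card ι : ℕ) : ℝ)) * ((((((L ^ k : ℕ) : ℝ)) ^ (d + 1)))⁻¹ * cE₀)) * Real.exp (-(δ * tdistT M y y'))) :=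
    (hasMaj_mulVecLin_transpose (g := unitTorusGeo L k M) (liftBlk (fun y : Tor M => y) ι) (liftBlk (fun b : Tor (fine (L ^ k) M) × Fin (d + 1) => blockOf (L ^ k) M b.1) ι) (K := fun y y' => (((((L ^ k : ℕ) : ℝ)) ^ (d + 1)))⁻¹ * cE₀ * Real.exp (-(δ * tdistT M y y')))
      (N := (d + 1) * (L ^ k) ^ (d + 1) * Fintype.card ι) (fun y y' => by positivity) (fun z => (card_fibre_blkV M (L ^ k) ι z).le) hE).mono fun y y' => le_of_eq (by rw [tdistT_symm M y' y]; ring)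
  -- `νS′ − S`
  have hS : HasMaj (BlockNorm.ofBlocks (unitTorusGeo L k M) (liftBlk (fun y : Tor M => y) ι)) (BlockNorm.ofBlocks (unitTorusGeo L k M) (liftBlk (fun y : Tor M => y) ι)) (Matrix.mulVecLin (((((L ^ m) ^ (d + 1) : ℕ) : ℝ)) • (cSop M (L ^ m * L ^ k) T' a') - (cSop M (L ^ k) T a)))
      (fun y y' => ((((((L ^ m * L ^ k) ^ (d + 1) * Fintype.card ι : ℕ) : ℝ) * ((((((L ^ m * L ^ k : ℕ) : ℝ)) ^ (d + 1)))⁻¹ * cM₁)) * ((((((L ^ k : ℕ) : ℝ)) ^ (d + 1)))⁻¹ * εM) * c + εMt * ((((((L ^ k : ℕ) : ℝ)) ^ (d + 1)))⁻¹ * cM₀) * c)) * Real.exp (-((δ - s) * tdistT M y y'))) := by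
    rw [mulVecLin_nu_cSop_sub]
    refine ((hasMaj_comp_exp (ρ := δ - s) htri hd hrow (by positivity) (by positivity) (by linarith) (by linarith) (by linarith) hMt' hDM).add
      (hasMaj_comp_exp (ρ := δ - s) htri hd hrow hεMt (by positivity) (by linarith) (by linarith) (by linarith) hDMt hM)).mono fun y y' => le_of_eq ?_
    rw [hκS1, hκS]; ring
  -- `𝔇(S⁻¹) = S′⁻¹ − νS⁻¹ = −S′⁻¹(νS′ − S)S⁻¹`
  have hDSi : HasMaj (BlockNorm.ofBlocks (unitTorusGeo L k M) (liftBlk (fun y : Tor M => y) ι)) (BlockNorm.ofBlocks (unitTorusGeo L k M) (liftBlk (fun y : Tor M => y) ι)) (idef (LinearMap.id : (Tor M × ι → ℝ) →ₗ[ℝ] (Tor M × ι → ℝ)) (((((L ^ m) ^ (d + 1) : ℕ) : ℝ)) • (LinearMap.id : (Tor M × ι → ℝ) →ₗ[ℝ] (Tor M × ι → ℝ))) (Matrix.mulVecLin ((cSop M (L ^ m * L ^ k) T' a'))⁻¹) (Matrix.mulVecLin ((cSop M (L ^ k) T a))⁻¹))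
      (fun y y' => ((((((L ^ m * L ^ k : ℕ) : ℝ)) ^ (d + 1)) * cS₁) * (((((((L ^ m * L ^ k) ^ (d + 1) * Fintype.card ι : ℕ) : ℝ) * ((((((L ^ m * L ^ k : ℕ) : ℝ)) ^ (d + 1)))⁻¹ * cM₁)) * ((((((L ^ k : ℕ) : ℝ)) ^ (d + 1)))⁻¹ * εM) * c + εMt * ((((((L ^ k : ℕ) : ℝ)) ^ (d + 1)))⁻¹ * cM₀) * c)) * (((((L ^ k : ℕ) : ℝ)) ^ (d + 1)) * cS₀) * c) * c) * Real.exp (-((δ - 3 * s) * tdistT M y y'))) := by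
    have hid : idef (LinearMap.id : (Tor M × ι → ℝ) →ₗ[ℝ] (Tor M × ι → ℝ)) (((((L ^ m) ^ (d + 1) : ℕ) : ℝ)) • (LinearMap.id : (Tor M × ι → ℝ) →ₗ[ℝ] (Tor M × ι → ℝ))) (Matrix.mulVecLin ((cSop M (L ^ m * L ^ k) T' a'))⁻¹) (Matrix.mulVecLin ((cSop M (L ^ k) T a))⁻¹) = -(Matrix.mulVecLin ((cSop M (L ^ m * L ^ k) T' a'))⁻¹ ∘ₗ (Matrix.mulVecLin (((((L ^ m) ^ (d + 1) : ℕ) : ℝ)) • (cSop M (L ^ m * L ^ k) T' a') - (cSop M (L ^ k) T a)) ∘ₗ Matrix.mulVecLin ((cSop M (L ^ k) T a))⁻¹)) := by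
      rw [idef, LinearMap.comp_id, LinearMap.smul_comp, LinearMap.id_comp, ← mulVecLin_smul', ← mulVecLin_sub', cSop_inv_sub_nu M L k m hT ha hT' ha', mulVecLin_neg', Matrix.mulVecLin_mul,
        Matrix.mulVecLin_mul, LinearMap.comp_assoc]
    rw [hid]
    have h1 := hasMaj_comp_exp (ρ := δ - 2 * s) htri hd hrow (by positivity) (by positivity) (by linarith) (by linarith) (by linarith) hS hSi
    exact ((hasMaj_comp_exp (ρ := δ - 3 * s) htri hd hrow (by positivity) (by rw [hκU]; positivity) (by linarith) (by linarith) (by linarith) hSi' h1).neg).mono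
      fun y y' => le_of_eq (by rw [hκU]; ring)
  -- the three words
  have hexp : idef (pull (liftMap (kingPrV L k m M) ι)) (pull (liftMap (kingPrV L k m M) ι)) (Matrix.mulVecLin (landauCov M (L ^ m * L ^ k) T' a')) (Matrix.mulVecLin (landauCov M (L ^ k) T a)) =
      Matrix.mulVecLin (cE M (L ^ m * L ^ k) T' a') ∘ₗ (Matrix.mulVecLin ((cSop M (L ^ m * L ^ k) T' a'))⁻¹ ∘ₗ idef (pull (liftMap (kingPrV L k m M) ι)) (LinearMap.id : (Tor M × ι → ℝ) →ₗ[ℝ] (Tor M × ι → ℝ)) (Matrix.mulVecLin ((cE M (L ^ m * L ^ k) T' a'))ᵀ) (Matrix.mulVecLin ((cE M (L ^ k) T a))ᵀ)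
          + idef (LinearMap.id : (Tor M × ι → ℝ) →ₗ[ℝ] (Tor M × ι → ℝ)) (((((L ^ m) ^ (d + 1) : ℕ) : ℝ)) • (LinearMap.id : (Tor M × ι → ℝ) →ₗ[ℝ] (Tor M × ι → ℝ))) (Matrix.mulVecLin ((cSop M (L ^ m * L ^ k) T' a'))⁻¹) (Matrix.mulVecLin ((cSop M (L ^ k) T a))⁻¹) ∘ₗ Matrix.mulVecLin ((cE M (L ^ k) T a))ᵀ)
        + idef (((((L ^ m) ^ (d + 1) : ℕ) : ℝ)) • (LinearMap.id : (Tor M × ι → ℝ) →ₗ[ℝ] (Tor M × ι → ℝ))) (pull (liftMap (kingPrV L k m M) ι)) (Matrix.mulVecLin (cE M (L ^ m * L ^ k) T' a')) (Matrix.mulVecLin (cE M (L ^ k) T a)) ∘ₗ (Matrix.mulVecLin ((cSop M (L ^ k) T a))⁻¹ ∘ₗ Matrix.mulVecLin ((cE M (L ^ k) T a))ᵀ) := by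
    rw [landauCov_eq, landauCov_eq, Matrix.mul_assoc, Matrix.mul_assoc, Matrix.mulVecLin_mul (cE M (L ^ m * L ^ k) T' a') (((cSop M (L ^ m * L ^ k) T' a'))⁻¹ * ((cE M (L ^ m * L ^ k) T' a'))ᵀ), Matrix.mulVecLin_mul ((cSop M (L ^ m * L ^ k) T' a'))⁻¹ ((cE M (L ^ m * L ^ k) T' a'))ᵀ,
      Matrix.mulVecLin_mul (cE M (L ^ k) T a) (((cSop M (L ^ k) T a))⁻¹ * ((cE M (L ^ k) T a))ᵀ), Matrix.mulVecLin_mul ((cSop M (L ^ k) T a))⁻¹ ((cE M (L ^ k) T a))ᵀ,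
      idef_comp (pull (liftMap (kingPrV L k m M) ι)) (((((L ^ m) ^ (d + 1) : ℕ) : ℝ)) • (LinearMap.id : (Tor M × ι → ℝ) →ₗ[ℝ] (Tor M × ι → ℝ))) (pull (liftMap (kingPrV L k m M) ι)) (Matrix.mulVecLin (cE M (L ^ m * L ^ k) T' a')) (Matrix.mulVecLin ((cSop M (L ^ m * L ^ k) T' a'))⁻¹ ∘ₗ Matrix.mulVecLin ((cE M (L ^ m * L ^ k) T' a'))ᵀ) (Matrix.mulVecLin (cE M (L ^ k) T a)) (Matrix.mulVecLin ((cSop M (L ^ k) T a))⁻¹ ∘ₗ Matrix.mulVecLin ((cE M (L ^ k) T a))ᵀ),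
      idef_comp (pull (liftMap (kingPrV L k m M) ι)) (LinearMap.id : (Tor M × ι → ℝ) →ₗ[ℝ] (Tor M × ι → ℝ)) (((((L ^ m) ^ (d + 1) : ℕ) : ℝ)) • (LinearMap.id : (Tor M × ι → ℝ) →ₗ[ℝ] (Tor M × ι → ℝ))) (Matrix.mulVecLin ((cSop M (L ^ m * L ^ k) T' a'))⁻¹) (Matrix.mulVecLin ((cE M (L ^ m * L ^ k) T' a'))ᵀ) (Matrix.mulVecLin ((cSop M (L ^ k) T a))⁻¹) (Matrix.mulVecLin ((cE M (L ^ k) T a))ᵀ)]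
  rw [hexp]
  have hL : (L : ℝ) ≠ 0 := Nat.cast_ne_zero.mpr (NeZero.ne L)
  -- T1 = E′·S′⁻¹·𝔇(Eᵀ)
  have t1a := hasMaj_comp_exp (ρ := δ - s) htri hd hrow (by positivity) hεEt (by linarith) (by linarith) (by linarith) hSi' hDEt
  have t1 := hasMaj_comp_exp (ρ := δ - 2 * s) htri hd hrow (by positivity) (by rw [hκU]; positivity) (by linarith) (by linarith) (by linarith) hE' t1a
  -- T2 = E′·𝔇(S⁻¹)·Eᵀ
  have t2a := hasMaj_comp_exp (ρ := δ - 4 * s) htri hd hrow (by positivity) (by positivity) (by linarith) (by linarith) (by linarith) hDSi hEt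
  have t2 := hasMaj_comp_exp (ρ := δ - 5 * s) htri hd hrow (by positivity) (by rw [hκU]; positivity) (by linarith) (by linarith) (by linarith) hE' t2a
  -- T3 = 𝔇(E)·S⁻¹·Eᵀ
  have t3a := hasMaj_comp_exp (ρ := δ - s) htri hd hrow (by positivity) (by positivity) (by linarith) (by linarith) (by linarith) hSi hEt
  have t3 := hasMaj_comp_exp (ρ := δ - 2 * s) htri hd hrow (by positivity) (by rw [hκU]; positivity) (by linarith) (by linarith) (by linarith) hDE t3a
  simp only [hκU] at t1 t2 t3
  have t1' := t1.of_rate_le hd (by positivity) (by linarith : δ - 5 * s ≤ δ - 2 * s)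
  have t3' := t3.of_rate_le hd (by positivity) (by linarith : δ - 5 * s ≤ δ - 2 * s)
  rw [LinearMap.comp_add]
  refine ((t1'.add t2).add t3').mono fun y y' => le_of_eq ?_
  push_cast
  field_simp

end Landau

end Summit.QuantumFields.YangMills.BalabanUVNodes.N15.CovLandau

end
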